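import Summits.QuantumFields.BalabanUV.T4Continuum.Support.SmallFieldDomainsMetric

/-!
# T⁴ programme, SUBSTRATE — `Support/SmallFieldDomainsMetricSep`: the LAYER-SEPARATION LOWER BOUND for the multiscale distance of a
# big-block domain sequence — [Balaban1984PropagatorsII] (2.60)'s shape «`d(y,y′) ≥ RM·max{|j−j′|−1, 0}`» PROVED from the (1.4) separation
# `dist(Ω_iᶜ, Ω_{i+1}) > RM₁L^i` of `BigDomainSeq.sep`: a path from the layer `j` to the layer `j′` pays, for every layer strictly between,
# at least `RM₁L^i` bonds of that layer

Audit cell `pub-balaban`, SUBSTRATE cell seat p4 (focus «small/large-field region bookkeeping · multiscale norms»; the S-GEOM companion of map item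
P4-6 = `Support/SmallFieldDomainsMetricSchur`, whose `exchange_powers` consumes a separation hypothesis of exactly this shape); same namespace as
`Support/SmallFieldDomains{,Norms,Metric}` (`BigDomainSeq`, `layer`, `ptIndex`, `Adj`/`IsPath`/`pathEnd`/`pathCost`, `msDist`, `layerWeight`, `msDistΩ`).

WHAT IS PRINTED (documentation; nothing printed is asserted).  T. Bałaban, *Propagators and renormalization transformations for lattice gauge
theories. II*, Commun. Math. Phys. **96** (1984) 223–250, Lemma 2.1 p. 234 (render `…1984-cmp96-propagators-rt-II-p012-x2.png`):
*"e^{−αδ₀d(y,y′)} ≦ e^{−αδ₀RM max{|j−j′|−1,0}}, y ∈ Λ_j, y′ ∈ Λ_{j′}, (2.60)"*, i.e. `d(y, y′) ≥ RM·max{|j − j′| − 1, 0}`, obtained there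
(pp. 231–232, (2.47)–(2.48), (2.57)) from the surfaces `Σ_j` separating `B^j(Λ_j)` from `B^{j−1}(Λ_{j−1})` and the condition (2.2) = [B8] (1.4)
«(L^jη)^{−1} dist(Ω_j^c, Ω_{j+1}) > RM₁».
WHAT THIS FILE PROVES (all `[folklore]`, for the cell's READING `msDistΩ` of (2.46) — unit-step paths through all fine points, a bond from a point
of index `i` costing at least `(s i)⁻¹/2`):
 * §1 path-cost algebra: `pathCost` is monotone and finitely additive in the weight (`pathCost_mono`, `pathCost_finset_sum`), the bond START
   points `pathStarts`, and `mul_le_pathCost_of_starts` (a per-bond lower bound on bonds starting in a set);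
 * §2 the sup-distance `supDist q z = max_i |q_i − z_i|` (`within_of_supDist_le`, `lt_supDist_of_not_within`, one step changes it by ≤ 1);
 * §3 **THE CROSSING LEMMA** `mul_le_pathCost_of_crossing`: if the sup-ball of radius `r` about every point of `A` lies in `Bs`, every bond
   starting in `Bs ∖ A` costs `≥ c ≥ 0` (and all bonds `≥ 0`), then every path from a point OUTSIDE `Bs` to a point of `A` costs `≥ c·r`
   (telescoping of the clamped potential `max{0, r − supDist(q, ·)}` along the prefix up to the first point `q` of `A`);
 * §4 **THE (2.60)-SHAPE BOUND** for a big-block domain sequence with positive scales: for `x ∈ Ω_j∖Ω_{j+1}`, `x′ ∈ Ω_{j′}∖Ω_{j′+1}`,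
   `Σ_{j<i<j′} (R·M₁·L^i)·(s i)⁻¹/2 ≤ d_Ω(x, x′)` (`sum_crossings_le_msDistΩ`, both orders of `j, j′`), and for GEOMETRIC scales `s i = c·L^i` the
   printed shape `(R·M₁/(2c))·(|j − j′| − 1) ≤ d_Ω(x, x′)` (`indexSep_msDistΩ`) — the hypothesis `hsep` of `SmallFieldDomainsMetricSchur.exchange_powers`
   with `D = R·M₁/(2c)` (the factor ½ is the price of the symmetric bond weight at the last bond of each crossing; print has `RM`).
COUNTERPART, NOT INSTANCE (XREAD INTERFACE-1, journal l.15089 ∕ l.15104).  `Literature/…/Balaban1983to89/B6Geometry.levelGap_dist` proves the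
same SHAPE `N·(|zone x − zone x′| − 1) ≤ dist x x′` for the UNWEIGHTED admissible-bond graph distance (`SimpleGraph.dist`; (2.46) as `dist246` of an
abstract `ContourSystem`) from the walk-form HYPOTHESIS `LevelGap N` (and `B6LevelGapMetric.levelGap_of_setSep` derives `LevelGap` from
(2.2)-shaped set data in a pseudo-metric space); its potential `height` = Σ_i of clamped collars is the all-level version of this file's one-level
`crossPot`.  HERE: the substrate's WEIGHTED FINE-PATH reading `msDistΩ` on `ℤ^d` (declared divergence (2.46)′ of `…Metric`), with the separation
DERIVED from `BigDomainSeq.sep` — no hypothesis.  NO inequality between `msDistΩ` and `dist246 ∘ ι` is claimed anywhere (the `ℤ^d`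
`ContourSystem` of a `BigDomainSeq` and that comparison are a booked follow-up); nothing of those modules is imported or restated.
HONEST FRAMING (T4-DAG p. 1).  Region∕metric GEOMETRY on `ℤ^d`; no configuration, no estimate of any NE row; spine 0/9 unchanged; NOT infinite
volume, NOT a mass gap, NOT Clay.  HONEST DEPENDENCY: continuum YM on T⁴ ⇐ BetaPertH ∧ nine spine estimates (0/9 proved); BetaPertH ⇐ (D1) ∧ (D4) ∧
CAP+tail; G-an2-4 gates asym, D1 and NE2/3/4.  No `sorry`.
-/

noncomputable section

open scoped BigOperators

namespace Summit.QuantumFields.BalabanUV.T4Continuum.SmallFieldDomains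

open Literature.MathematicalPhysics.QuantumFieldTheory.Balaban1983to89.B14DomainGeom
open Literature.MathematicalPhysics.QuantumFieldTheory.Balaban1983to89.B7Prop1Explicit (l1 e)

variable {d : ℕ}

/-! ## §1 Path-cost algebra -/

/-- `pathCost` is MONOTONE in the weight. [folklore] -/
theorem pathCost_mono {w w' : Pt d → Pt d → ℝ} (h : ∀ a b, w a b ≤ w' a b) :
    ∀ (x : Pt d) (l : List (Pt d)), pathCost w x l ≤ pathCost w' x l
  | _, [] => le_rfl
  | x, y :: l => add_le_add (h x y) (pathCost_mono h y l)

/-- `pathCost` is ADDITIVE in the weight over a finite family. [folklore] -/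
theorem pathCost_finset_sum {ι : Type*} (I : Finset ι) (W : ι → Pt d → Pt d → ℝ) :
    ∀ (x : Pt d) (l : List (Pt d)), pathCost (fun a b => ∑ i ∈ I, W i a b) x l = ∑ i ∈ I, pathCost (W i) x l
  | _, [] => by simp
  | x, y :: l => by
    simp only [pathCost_cons]
    rw [pathCost_finset_sum I W y l, Finset.sum_add_distrib]

/-- The START points of the bonds of a path `(x, [y₁, …, yₙ])`: `[x, y₁, …, yₙ₋₁]`. [folklore] -/
def pathStarts : Pt d → List (Pt d) → List (Pt d)
  | _, [] => []
  | x, y :: l => x :: pathStarts y l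

/-- No bonds, no starts. [folklore] -/
@[simp] theorem pathStarts_nil (x : Pt d) : pathStarts x [] = [] := rfl
/-- The starts after a first step. [folklore] -/
@[simp] theorem pathStarts_cons (x y : Pt d) (l : List (Pt d)) : pathStarts x (y :: l) = x :: pathStarts y l := rfl

/-- A path has as many starts as bonds. [folklore] -/
theorem length_pathStarts : ∀ (x : Pt d) (l : List (Pt d)), (pathStarts x l).length = l.length
  | _, [] => rfl
  | x, y :: l => by simp [length_pathStarts y l]

/-- PER-BOND LOWER BOUND ON A SET: if every bond starting in `T` costs at least `c`, all bonds cost `≥ 0`... more simply: if every START point of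
the path lies in `T`, the path costs at least `c` per bond. [folklore] -/
theorem mul_le_pathCost_of_starts {w : Pt d → Pt d → ℝ} {T : Set (Pt d)} {c : ℝ} (hwc : ∀ a b, a ∈ T → Adj a b → c ≤ w a b) :
    ∀ (x : Pt d) (l : List (Pt d)), IsPath x l → (∀ a ∈ pathStarts x l, a ∈ T) → c * l.length ≤ pathCost w x l
  | _, [], _, _ => by simp
  | x, y :: l, h, hT => by
    obtain ⟨hxy, hl⟩ := h
    rw [pathCost_cons, List.length_cons, Nat.cast_succ, mul_add, mul_one, add_comm (c * _)]
    refine add_le_add (hwc x y (hT x (by simp)) hxy) (mul_le_pathCost_of_starts hwc y l hl fun a ha => hT a ?_)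
    simp [ha]

/-! ## §2 The sup-distance and its one-step variation -/

/-- The SUP-DISTANCE `max_i |q_i − z_i|` on `ℤ^d` (a natural number; `0` for `d = 0`). [folklore] -/
def supDist (q z : Pt d) : ℕ := Finset.univ.sup fun i => (q i - z i).natAbs

/-- Each coordinate difference is at most the sup-distance. [folklore] -/
theorem natAbs_le_supDist (q z : Pt d) (i : Fin d) : (q i - z i).natAbs ≤ supDist q z :=
  Finset.le_sup (f := fun i => (q i - z i).natAbs) (Finset.mem_univ i)

/-- `supDist q q = 0`. [folklore] -/
@[simp] theorem supDist_self (q : Pt d) : supDist q q = 0 := by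
  simp [supDist]

/-- A sup-distance bound `≤ r` IS the sup-ball membership `Within r`. [folklore] -/
theorem within_of_supDist_le {q z : Pt d} {r : ℤ} (h : (supDist q z : ℤ) ≤ r) : Within r q z := fun i =>
  calc |q i - z i| = ((q i - z i).natAbs : ℤ) := (Int.natCast_natAbs _).symm
    _ ≤ supDist q z := by exact_mod_cast natAbs_le_supDist q z i
    _ ≤ r := h

/-- Outside the sup-ball of radius `r` the sup-distance exceeds `r`. [folklore] -/
theorem lt_supDist_of_not_within {q z : Pt d} {r : ℤ} (h : ¬ Within r q z) : r < supDist q z := by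
  simp only [Within, not_forall, not_le] at h
  obtain ⟨i, hi⟩ := h
  calc r < |q i - z i| := hi
    _ = ((q i - z i).natAbs : ℤ) := (Int.natCast_natAbs _).symm
    _ ≤ supDist q z := by exact_mod_cast natAbs_le_supDist q z i

/-- One unit step changes each coordinate by at most one. [folklore] -/
theorem natAbs_sub_le_one_of_adj {a b : Pt d} (h : Adj a b) (i : Fin d) : (b i - a i).natAbs ≤ 1 := by
  obtain ⟨μ, h | h⟩ := h
  · have e1 : b i - a i = e μ i := by rw [h, Pi.add_apply]; ring
    rw [e1]
    by_cases hi : i = μ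
    · subst hi; simp [e]
    · simp [e, Pi.single_eq_of_ne hi]
  · have e1 : b i - a i = -(e μ i) := by rw [h, Pi.sub_apply]; ring
    rw [e1, Int.natAbs_neg]
    by_cases hi : i = μ
    · subst hi; simp [e]
    · simp [e, Pi.single_eq_of_ne hi]

/-- ONE STEP moves the sup-distance to any base point by at most one: `supDist q a ≤ supDist q b + 1` for adjacent `a, b`. [folklore] -/
theorem supDist_le_succ_of_adj (q : Pt d) {a b : Pt d} (h : Adj a b) : supDist q a ≤ supDist q b + 1 := by
  refine Finset.sup_le fun i _ => ?_
  have h1 : (q i - a i).natAbs ≤ (q i - b i).natAbs + (b i - a i).natAbs := by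
    have e1 : q i - a i = (q i - b i) + (b i - a i) := by ring
    rw [e1]; exact Int.natAbs_add_le _ _
  exact h1.trans (add_le_add (natAbs_le_supDist q b i) (natAbs_sub_le_one_of_adj h i))

/-! ## §3 The crossing lemma -/

section Crossing
variable {w : Pt d → Pt d → ℝ} {A Bs : Set (Pt d)} {r : ℕ} {c : ℝ} {q : Pt d}

/-- The CLAMPED POTENTIAL `max{0, r − supDist(q, z)}`: zero outside the sup-ball of radius `r − 1` about `q`, equal to `r` at `q`, moving by
at most one per unit step. [folklore] -/
def crossPot (r : ℕ) (q z : Pt d) : ℝ := max 0 ((r : ℝ) - (supDist q z : ℝ))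

/-- `crossPot r q q = r`. [folklore] -/
theorem crossPot_self (r : ℕ) (q : Pt d) : crossPot r q q = r := by
  simp [crossPot]

/-- `0 ≤ crossPot`. [folklore] -/
theorem crossPot_nonneg (r : ℕ) (q z : Pt d) : 0 ≤ crossPot r q z := le_max_left _ _

/-- Outside the sup-ball of radius `r` about `q` the potential vanishes. [folklore] -/
theorem crossPot_eq_zero_of_not_within {z : Pt d} (h : ¬ Within (r : ℤ) q z) : crossPot r q z = 0 := by
  have h1 : (r : ℤ) < supDist q z := lt_supDist_of_not_within h
  have h2 : (r : ℝ) < (supDist q z : ℝ) := by exact_mod_cast h1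
  unfold crossPot
  exact max_eq_left (by linarith)

/-- **THE BOND INEQUALITY**: if the sup-ball of radius `r` about `q` lies in `Bs`, bonds starting in `Bs ∖ A` cost `≥ c ≥ 0` and all bonds
cost `≥ 0`, then along any bond `(a, b)` with `a ∉ A` the potential rises by at most `w a b / c`: `c·(crossPot b − crossPot a) ≤ w a b`.
(If the potential rises at all, `b` is within `r − 1` of `q`, so `a` is within `r`, so `a ∈ Bs`; and it rises by at most one.) [folklore] -/
theorem mul_crossPot_sub_le (hball : ∀ z, Within (r : ℤ) q z → z ∈ Bs) (hw0 : ∀ a b, 0 ≤ w a b) (hc : 0 ≤ c)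
    (hwc : ∀ a b, a ∈ Bs → a ∉ A → Adj a b → c ≤ w a b) {a b : Pt d} (hab : Adj a b) (ha : a ∉ A) :
    c * (crossPot r q b - crossPot r q a) ≤ w a b := by
  by_cases hle : crossPot r q b ≤ crossPot r q a
  · exact le_trans (mul_nonpos_of_nonneg_of_nonpos hc (by linarith)) (hw0 a b)
  · push Not at hle
    -- the potential rises: `crossPot b = r − D b > 0`
    have hbpos : 0 < crossPot r q b := lt_of_le_of_lt (crossPot_nonneg r q a) hle
    have hb : crossPot r q b = (r : ℝ) - (supDist q b : ℝ) := by
      unfold crossPot at hbpos ⊢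
      rcases le_or_gt ((r : ℝ) - (supDist q b : ℝ)) 0 with h | h
      · rw [max_eq_left h] at hbpos; exact absurd hbpos (lt_irrefl 0)
      · exact max_eq_right h.le
    have hDb : supDist q b + 1 ≤ r := by
      have : (supDist q b : ℝ) < r := by rw [hb] at hbpos; linarith
      exact_mod_cast this
    -- hence `a` is within `r` of `q`, so `a ∈ Bs` and the bond costs `≥ c`
    have hDa : supDist q a ≤ r := (supDist_le_succ_of_adj q hab).trans hDb
    have haBs : a ∈ Bs := hball a (within_of_supDist_le (by exact_mod_cast hDa))
    have hcw : c ≤ w a b := hwc a b haBs ha hab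
    -- and the rise is at most one
    have hrise : crossPot r q b - crossPot r q a ≤ 1 := by
      have h1 : (r : ℝ) - (supDist q a : ℝ) ≤ crossPot r q a := le_max_right _ _
      have h2 : (supDist q a : ℝ) ≤ (supDist q b : ℝ) + 1 := by exact_mod_cast supDist_le_succ_of_adj q hab
      rw [hb]; linarith
    calc c * (crossPot r q b - crossPot r q a) ≤ c * 1 := mul_le_mul_of_nonneg_left hrise hc
      _ = c := mul_one c
      _ ≤ w a b := hcw

/-- TELESCOPING: along a path all of whose bond starts avoid `A`, the cost dominates `c` times the total rise of the potential. [folklore] -/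
theorem mul_crossPot_le_pathCost (hball : ∀ z, Within (r : ℤ) q z → z ∈ Bs) (hw0 : ∀ a b, 0 ≤ w a b) (hc : 0 ≤ c)
    (hwc : ∀ a b, a ∈ Bs → a ∉ A → Adj a b → c ≤ w a b) :
    ∀ (x : Pt d) (l : List (Pt d)), IsPath x l → (∀ a ∈ pathStarts x l, a ∉ A) →
      c * (crossPot r q (pathEnd x l) - crossPot r q x) ≤ pathCost w x l
  | x, [], _, _ => by simp
  | x, y :: l, h, hA => by
    obtain ⟨hxy, hl⟩ := h
    have hx : x ∉ A := hA x (by simp)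
    have ih := mul_crossPot_le_pathCost hball hw0 hc hwc y l hl fun a ha => hA a (by simp [ha])
    have hb := mul_crossPot_sub_le hball hw0 hc hwc hxy hx
    rw [pathEnd_cons, pathCost_cons]
    have e1 : c * (crossPot r q (pathEnd y l) - crossPot r q x) =
        c * (crossPot r q y - crossPot r q x) + c * (crossPot r q (pathEnd y l) - crossPot r q y) := by ring
    rw [e1]
    exact add_le_add hb ih

/-- THE PREFIX UP TO THE FIRST POINT OF `A`: a path from `x ∉ A` ending in `A` has a prefix ending in `A` all of whose bond starts avoid `A`,
of no larger cost (non-negative weight). [folklore] -/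
theorem exists_prefix_to_first (hw0 : ∀ a b, 0 ≤ w a b) :
    ∀ (x : Pt d) (l : List (Pt d)), IsPath x l → x ∉ A → pathEnd x l ∈ A →
      ∃ p, IsPath x p ∧ pathEnd x p ∈ A ∧ (∀ a ∈ pathStarts x p, a ∉ A) ∧ pathCost w x p ≤ pathCost w x l
  | x, [], _, hx, hend => absurd (by simpa using hend) hx
  | x, y :: l, h, hx, hend => by
    classical
    obtain ⟨hxy, hl⟩ := h
    by_cases hy : y ∈ A
    · refine ⟨[y], ⟨hxy, trivial⟩, by simpa using hy, fun a ha => ?_, ?_⟩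
      · simp only [pathStarts_cons, pathStarts_nil, List.mem_singleton] at ha
        rw [ha]; exact hx
      · rw [pathCost_cons, pathCost_cons, pathCost_nil, add_zero]
        exact le_add_of_nonneg_right (pathCost_nonneg hw0 y l)
    · rw [pathEnd_cons] at hend
      obtain ⟨p, hp, hpe, hpA, hpc⟩ := exists_prefix_to_first hw0 y l hl hy hend
      refine ⟨y :: p, ⟨hxy, hp⟩, by simpa using hpe, fun a ha => ?_, ?_⟩
      · simp only [pathStarts_cons, List.mem_cons] at ha
        rcases ha with rfl | ha
        · exact hx
        · exact hpA a ha
      · rw [pathCost_cons, pathCost_cons]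
        exact add_le_add le_rfl hpc

/-- **THE CROSSING LEMMA**: if the sup-ball of radius `r` about every point of `A` lies in `Bs`, bonds starting in `Bs ∖ A` cost `≥ c ≥ 0` and
all bonds cost `≥ 0`, then every path from a point `x ∉ Bs` to a point of `A` costs at least `c·r` (the `r` steps from sup-distance `r` down to
`0` from the first point of `A` all start inside `Bs ∖ A`). [folklore] -/
theorem mul_le_pathCost_of_crossing (hsep : ∀ q ∈ A, ∀ z, Within (r : ℤ) q z → z ∈ Bs) (hw0 : ∀ a b, 0 ≤ w a b) (hc : 0 ≤ c)
    (hwc : ∀ a b, a ∈ Bs → a ∉ A → Adj a b → c ≤ w a b) {x : Pt d} {l : List (Pt d)} (hl : IsPath x l) (hx : x ∉ Bs)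
    (hend : pathEnd x l ∈ A) : c * r ≤ pathCost w x l := by
  have hxA : x ∉ A := fun hxA => hx (hsep x hxA x fun i => by simp)
  obtain ⟨p, hp, hpe, hpA, hpc⟩ := exists_prefix_to_first hw0 x l hl hxA hend
  set q := pathEnd x p with hq
  have hball : ∀ z, Within (r : ℤ) q z → z ∈ Bs := hsep q hpe
  have htel := mul_crossPot_le_pathCost hball hw0 hc hwc x p hp hpA
  have hxq : ¬ Within (r : ℤ) q x := fun hw => hx (hball x hw)
  rw [← hq, crossPot_self, crossPot_eq_zero_of_not_within hxq, sub_zero] at htel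
  exact htel.trans hpc

end Crossing

/-! ## §4 The (2.60)-shape layer-separation bound for `msDistΩ` -/

section LayerSep
variable {L M₁ R k : ℕ} {Ω : ℕ → Set (Pt d)} {s : ℕ → ℝ}

open Classical in
/-- The per-layer weight piece: a bond STARTING in the layer `i` is charged `(s i)⁻¹/2`, nothing else. [folklore] -/
def layerPiece (s : ℕ → ℝ) (Ω : ℕ → Set (Pt d)) (i : ℕ) (a _b : Pt d) : ℝ :=
  if a ∈ layer Ω i then (s i)⁻¹ / 2 else 0

/-- The pieces are non-negative (positive scales). [folklore] -/
theorem layerPiece_nonneg (hs : ∀ j, 0 < s j) (i : ℕ) (a b : Pt d) : 0 ≤ layerPiece s Ω i a b := by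
  unfold layerPiece
  split_ifs
  · exact div_nonneg (inv_nonneg.mpr (hs i).le) (by norm_num)
  · exact le_rfl

/-- THE WEIGHT DOMINATES THE SUM OF ITS LAYER PIECES: a bond starting at a point of index `i` costs
`((s i)⁻¹ + (s ι(b))⁻¹)/2 ≥ (s i)⁻¹/2`, and at most one piece is non-zero (layers are disjoint). [folklore] -/
theorem sum_layerPiece_le_layerWeight (hΩ : BigDomainSeq L M₁ R k Ω) (hs : ∀ j, 0 < s j) (I : Finset ℕ) (a b : Pt d) :
    ∑ i ∈ I, layerPiece s Ω i a b ≤ layerWeight s k Ω a b := by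
  classical
  have hwb : 0 ≤ (s (ptIndex k Ω b))⁻¹ := inv_nonneg.mpr (hs _).le
  by_cases ha : a ∈ Ω 0
  · -- only the piece `i = ι(a)` can be non-zero
    have hval : ∀ i ∈ I, layerPiece s Ω i a b = if i = ptIndex k Ω a then (s i)⁻¹ / 2 else 0 := by
      intro i _
      unfold layerPiece
      by_cases hi : i = ptIndex k Ω a
      · rw [if_pos hi, if_pos ((mem_layer_iff_ptIndex hΩ ha).mpr hi.symm)]
      · rw [if_neg hi, if_neg (fun h => hi ((mem_layer_iff_ptIndex hΩ ha).mp h).symm)]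
    rw [Finset.sum_congr rfl hval, Finset.sum_ite_eq']
    unfold layerWeight
    split_ifs
    · linarith
    · have : 0 ≤ (s (ptIndex k Ω a))⁻¹ := inv_nonneg.mpr (hs _).le
      linarith
  · -- outside `Ω₀` no piece is charged
    have hval : ∀ i ∈ I, layerPiece s Ω i a b = 0 := by
      intro i _
      unfold layerPiece
      rw [if_neg (fun h => ha (mem_zero_of_mem_layer hΩ h))]
    rw [Finset.sum_congr rfl hval, Finset.sum_const_zero]
    exact layerWeight_nonneg s k Ω hs a b

/-- ONE CROSSING: a path from a point outside `Ω_i` to a point of `Ω_{i+1}` pays at least `(R·M₁·L^i)·(s i)⁻¹/2` in the layer-`i` piece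
(the crossing lemma with `A = Ω_{i+1}`, `Bs = Ω_i`, radius `R·M₁·L^i` from `BigDomainSeq.sep`, and `Bs ∖ A` = the layer `i`). [folklore] -/
theorem crossing_le_pathCost_layerPiece (hΩ : BigDomainSeq L M₁ R k Ω) (hs : ∀ j, 0 < s j) (i : ℕ) {x : Pt d} {l : List (Pt d)}
    (hl : IsPath x l) (hx : x ∉ Ω i) (hend : pathEnd x l ∈ Ω (i + 1)) :
    (s i)⁻¹ / 2 * ((R * M₁ * L ^ i : ℕ) : ℝ) ≤ pathCost (layerPiece s Ω i) x l := by
  refine mul_le_pathCost_of_crossing (A := Ω (i + 1)) (Bs := Ω i) (r := R * M₁ * L ^ i) (fun q hq z hz => hΩ.sep i q hq z ?_)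
    (layerPiece_nonneg hs i) (div_nonneg (inv_nonneg.mpr (hs i).le) (by norm_num)) (fun a b ha hna _ => ?_) hl hx hend
  · simpa using hz
  · unfold layerPiece
    rw [if_pos (mem_layer.mpr ⟨ha, hna⟩)]

/-- **THE (2.60)-SHAPE BOUND, ordered indices**: for `x` in the layer `j` and `x′` in the layer `j′`, `j ≤ j′`, every layer `i` strictly between is
crossed: `Σ_{i ∈ (j, j′)} (R·M₁·L^i)·(s i)⁻¹/2 ≤ d_Ω(x, x′)`. [folklore] -/
theorem sum_crossings_le_msDistΩ (hΩ : BigDomainSeq L M₁ R k Ω) (hs : ∀ j, 0 < s j) {j j' : ℕ} {x x' : Pt d}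
    (hx : x ∈ layer Ω j) (hx' : x' ∈ layer Ω j') :
    ∑ i ∈ Finset.Ioo j j', (s i)⁻¹ / 2 * ((R * M₁ * L ^ i : ℕ) : ℝ) ≤ msDistΩ s k Ω x x' := by
  refine le_msDist fun l hl hend => ?_
  -- each crossed layer separately, on its own weight piece
  have hpiece : ∀ i ∈ Finset.Ioo j j', (s i)⁻¹ / 2 * ((R * M₁ * L ^ i : ℕ) : ℝ) ≤ pathCost (layerPiece s Ω i) x l := by
    intro i hi
    rw [Finset.mem_Ioo] at hi
    have hxi : x ∉ Ω i := fun h => hx.2 (hΩ.anti_le (by omega : j + 1 ≤ i) h)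
    have hend' : pathEnd x l ∈ Ω (i + 1) := by rw [hend]; exact hΩ.anti_le (by omega : i + 1 ≤ j') hx'.1
    exact crossing_le_pathCost_layerPiece hΩ hs i hl hxi hend'
  calc ∑ i ∈ Finset.Ioo j j', (s i)⁻¹ / 2 * ((R * M₁ * L ^ i : ℕ) : ℝ)
      ≤ ∑ i ∈ Finset.Ioo j j', pathCost (layerPiece s Ω i) x l := Finset.sum_le_sum hpiece
    _ = pathCost (fun a b => ∑ i ∈ Finset.Ioo j j', layerPiece s Ω i a b) x l := (pathCost_finset_sum _ _ x l).symm
    _ ≤ pathCost (layerWeight s k Ω) x l := pathCost_mono (sum_layerPiece_le_layerWeight hΩ hs _) x l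

/-- The same bound with the indices in the other order (symmetry of `d_Ω`). [folklore] -/
theorem sum_crossings_le_msDistΩ' (hΩ : BigDomainSeq L M₁ R k Ω) (hs : ∀ j, 0 < s j) {j j' : ℕ} {x x' : Pt d}
    (hx : x ∈ layer Ω j) (hx' : x' ∈ layer Ω j') :
    ∑ i ∈ Finset.Ioo j' j, (s i)⁻¹ / 2 * ((R * M₁ * L ^ i : ℕ) : ℝ) ≤ msDistΩ s k Ω x x' := by
  rw [msDistΩ_comm s k Ω hs]
  exact sum_crossings_le_msDistΩ hΩ hs hx' hx

/-- Counting the layers strictly between two indices: `#(j, j′) + #(j′, j) = |j − j′| − 1` whenever `j ≠ j′` (and `0` if `j = j′`); in the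
form used below: `(|j − j′| − 1 : ℝ) ≤ #(Ioo j j′) + #(Ioo j′ j)`. [folklore] -/
theorem natAbs_sub_one_le_card_Ioo (j j' : ℕ) :
    ((((j : ℤ) - j').natAbs : ℕ) : ℝ) - 1 ≤ ((Finset.Ioo j j').card : ℝ) + ((Finset.Ioo j' j).card : ℝ) := by
  rw [Nat.card_Ioo, Nat.card_Ioo]
  have h : ((j : ℤ) - j').natAbs ≤ (j' - j - 1) + (j - j' - 1) + 1 := by omega
  have h' : ((((j : ℤ) - j').natAbs : ℕ) : ℝ) ≤ ((j' - j - 1 : ℕ) : ℝ) + ((j - j' - 1 : ℕ) : ℝ) + 1 := by exact_mod_cast h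
  linarith

/-- **THE PRINTED SHAPE FOR GEOMETRIC SCALES** `s i = c·L^i` (`c > 0`, `1 ≤ L`): every crossing costs the SAME amount `R·M₁/(2c)`, so
`(R·M₁/(2c))·(|j − j′| − 1) ≤ d_Ω(x, x′)` for `x` of index `j` and `x′` of index `j′` — [B6] (2.60)'s «`d(y,y′) ≥ RM·max{|j−j′|−1,0}`» for the
cell's reading, with `D = R·M₁/(2c)`; this is the hypothesis `hsep` of `SmallFieldDomainsMetricSchur.exchange_powers`. [folklore] -/
theorem indexSep_msDistΩ (hΩ : BigDomainSeq L M₁ R k Ω) {c : ℝ} (hc : 0 < c) (hL : 1 ≤ L) (hsc : ∀ i, s i = c * (L : ℝ) ^ i)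
    {j j' : ℕ} {x x' : Pt d} (hx : x ∈ layer Ω j) (hx' : x' ∈ layer Ω j') :
    (R * M₁ : ℝ) / (2 * c) * (((((j : ℤ) - j').natAbs : ℕ) : ℝ) - 1) ≤ msDistΩ s k Ω x x' := by
  have hL0 : (0 : ℝ) < L := by exact_mod_cast (lt_of_lt_of_le Nat.zero_lt_one hL)
  have hs : ∀ i, 0 < s i := fun i => by rw [hsc i]; positivity
  -- every crossing costs `R M₁/(2c)`
  have hterm : ∀ i, (s i)⁻¹ / 2 * ((R * M₁ * L ^ i : ℕ) : ℝ) = (R * M₁ : ℝ) / (2 * c) := by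
    intro i
    rw [hsc i]
    have hLi : (L : ℝ) ^ i ≠ 0 := pow_ne_zero i hL0.ne'
    push_cast
    field_simp
  have hD : 0 ≤ (R * M₁ : ℝ) / (2 * c) := by positivity
  have h1 := sum_crossings_le_msDistΩ hΩ hs hx hx'
  have h2 := sum_crossings_le_msDistΩ' hΩ hs hx hx'
  simp only [hterm, Finset.sum_const, nsmul_eq_mul] at h1 h2
  have hd0 : 0 ≤ msDistΩ s k Ω x x' := msDistΩ_nonneg s k Ω hs x x'
  -- one of the two intervals is empty; use `|j − j′| − 1 ≤ #Ioo j j′ + #Ioo j′ j` and that each product is `≤ d`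
  have hcount := natAbs_sub_one_le_card_Ioo j j'
  rcases le_or_gt j j' with h | h
  · have he : (Finset.Ioo j' j).card = 0 := by rw [Nat.card_Ioo]; omega
    rw [he, Nat.cast_zero, add_zero] at hcount
    calc (R * M₁ : ℝ) / (2 * c) * (((((j : ℤ) - j').natAbs : ℕ) : ℝ) - 1)
        ≤ (R * M₁ : ℝ) / (2 * c) * ((Finset.Ioo j j').card : ℝ) := mul_le_mul_of_nonneg_left hcount hD
      _ = ((Finset.Ioo j j').card : ℝ) * ((R * M₁ : ℝ) / (2 * c)) := mul_comm _ _
      _ ≤ msDistΩ s k Ω x x' := h1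
  · have he : (Finset.Ioo j j').card = 0 := by rw [Nat.card_Ioo]; omega
    rw [he, Nat.cast_zero, zero_add] at hcount
    calc (R * M₁ : ℝ) / (2 * c) * (((((j : ℤ) - j').natAbs : ℕ) : ℝ) - 1)
        ≤ (R * M₁ : ℝ) / (2 * c) * ((Finset.Ioo j' j).card : ℝ) := mul_le_mul_of_nonneg_left hcount hD
      _ = ((Finset.Ioo j' j).card : ℝ) * ((R * M₁ : ℝ) / (2 * c)) := mul_comm _ _
      _ ≤ msDistΩ s k Ω x x' := h2

/-- The bound read AT THE POINT INDEX for two points of `Ω₀` (`ι = ptIndex k Ω`). [folklore] -/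
theorem indexSep_msDistΩ_ptIndex (hΩ : BigDomainSeq L M₁ R k Ω) {c : ℝ} (hc : 0 < c) (hL : 1 ≤ L) (hsc : ∀ i, s i = c * (L : ℝ) ^ i)
    {x x' : Pt d} (hx : x ∈ Ω 0) (hx' : x' ∈ Ω 0) :
    (R * M₁ : ℝ) / (2 * c) * (((((ptIndex k Ω x : ℤ) - ptIndex k Ω x').natAbs : ℕ) : ℝ) - 1) ≤ msDistΩ s k Ω x x' :=
  indexSep_msDistΩ hΩ hc hL hsc (mem_layer_ptIndex hΩ hx) (mem_layer_ptIndex hΩ hx')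

end LayerSep

end Summit.QuantumFields.BalabanUV.T4Continuum.SmallFieldDomains

end
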